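import Summits.Ventures.HSemireg.LeadingDigitRemainder
import Summits.Ventures.HSemireg.TwoVectorDividedPowers
import Summits.Ventures.HSemireg.EdgeUnitClosedForms

/-!
# The (1,2,3,3,3,3) frame is CLASS-DEAD — one theorem (pub-hsemireg, S4-PUSH corner 2)

Kernel leg of seat s4-search-2 gen 16 (cell `pub-hsemireg`); companion of `EdgeUnitClassDead.lean` for the OTHER frame of
the M2 cell with a non-degenerate leading digit on the slot pair `0, 1`: dual type `c′ = (1,2,3,3,3,3)` (63 twisted M2
census classes; memo `s4push/search-2/g11/LIFT2-search-2-g11.md` «S2-21» §5 LEMMA A(b); RESULT «S2-19» ADDENDUM B =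
S4-PR-54 ∕ «S2-21» = S4-PR-57).  Of record: `MixedFrameLeadingDigit.T2_leading_mixed` ∕ `obstruction_mixed` (gen 13, k =
211), `MixedFrameGlue.obstruction_mixed_exterior` (gen 14, k = 235), `TwoAdicReadings.lemmaA_b_reading` (gen 15, ROW A:
the digit equation `e·h₀h₁ + h₀S₁ + C·X = 2W` has no solution, GIVEN a functional `f = f₀₁h₀ + f₂₃h₁ + F` with `f₂₃` odd
and even pairing); pencil so far: «criterion at `k = 2` ⇒ the digit equation» for this frame and «such an `f` exists
for every non-degenerate leading digit (three parity cases)».  This file closes both and composes: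

* `mixed_coverage` (over `ℤ`): for integers `β₀₁ β₂₃ n₁ … n₄` with ODD Pfaffian `β₀₁β₂₃ + (n₂n₃ − n₁n₄) = 2p + 1`
  there are integers `f₀₁, f₂₃ = 2r + 1, c₁ … c₄, m` with `f₀₁β₂₃ + f₂₃β₀₁ + (c₂n₃ + c₃n₂ − c₁n₄ − c₄n₁) = 2m` —
  the memo's three cases (`β₀₁` even ⟹ `f = h₁`; `β₀₁, β₂₃` odd ⟹ `f = h₀ + h₁`; `β₀₁` odd, `β₂₃` even ⟹ the
  Pfaffian forces some `nᵢ` odd, `f = h₁ ∓` the complementary cross line).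
* `lemmaA_b_chain` (the analogue of `LeadingDigitRemainder.lemmaA_a_chain`): in `ExteriorAlgebra ℤ M` (`M` free, basis
  `x : Fin 12`), for a non-degenerate leading digit, a functional as above, ANY first digit `X` and remainder `Y`
  (even elements, registered divided square `E` of `C + 2X + 4Y`), the registered `T₂` of the `(1,2,3,3,3,3)` type
  (`D = 2h₀ + 4h₁ + 8S₁`, `σ₁ = 0`, `σ₀ = 2s + 1`, `σ₂ = 4t + 2`): IF `T₂ = 64·Z` (`Z` even) THEN `False`
  (`T2_leading_mixed` in the commutative `Λ` ⇒ `T₂ = 32·((t+s+p+1)h₀h₁ + h₀S₁ + CX) + 64·W₁`; cancel `32`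
  (`natCast_mul_cancel`); `lemmaA_b_reading`).
* `mixedFrame_classDead` (THE STATEMENT): for an INTEGRAL leading digit with odd Pfaffian, ANY integral 2-form `X` (66
  coefficients), the class 2-form `B = C + 2X` and ANY `B₂` with `B·B = 2B₂` (its divided square), the registered
  `T₂(B) = σ₂D₂ − 4σ₁DB + 16σ₀B₂` of the `(1,2,3,3,3,3)` type: `∀ Z ∈ Λ, T₂(B) ≠ 64·Z` — CRITERION L fails at `k = 2`
  for EVERY completion of EVERY non-degenerate leading digit; no enumerative or closed-form GIVEN (the closed form of
  `B₂` is produced by `EdgeUnitClosedForms.closedForms_leading` + `TwoVectorDividedPowers` + `cancel_two`).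

Scope ∕ honest framing as in `EdgeUnitClassDead`: the CLASS-LEVEL statement for ONE unit of a NECESSARY-condition sieve
(CRITERION L) at the special fibre `E⁶`; that CRITERION L is the registered necessary condition, the signature table
(`σ₁ = 0`, `v₂(σ₂) = 1`, `σ₀` odd for these classes) and the census are framework words; theorems only (count-neutral, no
`def`); no object, no `σ` computation, no Hodge statement; nothing here bears on HC ∕ HC_CM ∕ HC_AV.
-/

namespace Summit.Ventures.HSemireg.MixedFrameClassDead

open ExteriorAlgebra TwoSlotFrameTable MixedFrameLeadingDigit TwoAdicReadings LeadingDigitRemainder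
  TwoVectorDividedPowers EdgeUnitClosedForms
open scoped IsMulCommutative

section LocalTools

/-! ### 0. Local tools (restated from ROW J so that this file imports only the rows it uses) -/

variable {M : Type*} [AddCommGroup M] [Module ℤ M]

/-- Cancelling `2` (torsion-freeness, `LeadingDigitRemainder.natCast_mul_cancel`). -/
theorem cancel_two (x : Module.Basis (Fin 12) ℤ M) {Q Q' : ExteriorAlgebra ℤ M}
    (h : (2 : ExteriorAlgebra ℤ M) * Q = 2 * Q') : Q = Q' :=
  LeadingDigitRemainder.natCast_mul_cancel x 2 (by norm_num) Q Q' (by exact_mod_cast h)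

set_option maxRecDepth 4000 in
/-- An integral 2-form on the basis (the 66-term shape of `DigitSpaceClause` ∕ `EdgeDigitParametrisation`) lies in the
span of the 2-vectors. -/
theorem twoForm_mem_span (x : Module.Basis (Fin 12) ℤ M) (c : Fin 12 → Fin 12 → ℤ) :
    c 0 1 • (ι ℤ (x 0) * ι ℤ (x 1)) + c 0 2 • (ι ℤ (x 0) * ι ℤ (x 2)) + c 0 3 • (ι ℤ (x 0) * ι ℤ (x 3)) + c 0 4 •
      (ι ℤ (x 0) * ι ℤ (x 4)) + c 0 5 • (ι ℤ (x 0) * ι ℤ (x 5)) + c 0 6 • (ι ℤ (x 0) * ι ℤ (x 6)) + c 0 7 • (ι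
      ℤ (x 0) * ι ℤ (x 7)) + c 0 8 • (ι ℤ (x 0) * ι ℤ (x 8)) + c 0 9 • (ι ℤ (x 0) * ι ℤ (x 9)) + c 0 10 • (ι ℤ
      (x 0) * ι ℤ (x 10)) + c 0 11 • (ι ℤ (x 0) * ι ℤ (x 11)) + c 1 2 • (ι ℤ (x 1) * ι ℤ (x 2)) + c 1 3 • (ι ℤ
      (x 1) * ι ℤ (x 3)) + c 1 4 • (ι ℤ (x 1) * ι ℤ (x 4)) + c 1 5 • (ι ℤ (x 1) * ι ℤ (x 5)) + c 1 6 • (ι ℤ (x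
      1) * ι ℤ (x 6)) + c 1 7 • (ι ℤ (x 1) * ι ℤ (x 7)) + c 1 8 • (ι ℤ (x 1) * ι ℤ (x 8)) + c 1 9 • (ι ℤ (x 1)
      * ι ℤ (x 9)) + c 1 10 • (ι ℤ (x 1) * ι ℤ (x 10)) + c 1 11 • (ι ℤ (x 1) * ι ℤ (x 11)) + c 2 3 • (ι ℤ (x
      2) * ι ℤ (x 3)) + c 2 4 • (ι ℤ (x 2) * ι ℤ (x 4)) + c 2 5 • (ι ℤ (x 2) * ι ℤ (x 5)) + c 2 6 • (ι ℤ (x 2)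
      * ι ℤ (x 6)) + c 2 7 • (ι ℤ (x 2) * ι ℤ (x 7)) + c 2 8 • (ι ℤ (x 2) * ι ℤ (x 8)) + c 2 9 • (ι ℤ (x 2) *
      ι ℤ (x 9)) + c 2 10 • (ι ℤ (x 2) * ι ℤ (x 10)) + c 2 11 • (ι ℤ (x 2) * ι ℤ (x 11)) + c 3 4 • (ι ℤ (x 3)
      * ι ℤ (x 4)) + c 3 5 • (ι ℤ (x 3) * ι ℤ (x 5)) + c 3 6 • (ι ℤ (x 3) * ι ℤ (x 6)) + c 3 7 • (ι ℤ (x 3) *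
      ι ℤ (x 7)) + c 3 8 • (ι ℤ (x 3) * ι ℤ (x 8)) + c 3 9 • (ι ℤ (x 3) * ι ℤ (x 9)) + c 3 10 • (ι ℤ (x 3) * ι
      ℤ (x 10)) + c 3 11 • (ι ℤ (x 3) * ι ℤ (x 11)) + c 4 5 • (ι ℤ (x 4) * ι ℤ (x 5)) + c 4 6 • (ι ℤ (x 4) * ι
      ℤ (x 6)) + c 4 7 • (ι ℤ (x 4) * ι ℤ (x 7)) + c 4 8 • (ι ℤ (x 4) * ι ℤ (x 8)) + c 4 9 • (ι ℤ (x 4) * ι ℤ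
      (x 9)) + c 4 10 • (ι ℤ (x 4) * ι ℤ (x 10)) + c 4 11 • (ι ℤ (x 4) * ι ℤ (x 11)) + c 5 6 • (ι ℤ (x 5) * ι
      ℤ (x 6)) + c 5 7 • (ι ℤ (x 5) * ι ℤ (x 7)) + c 5 8 • (ι ℤ (x 5) * ι ℤ (x 8)) + c 5 9 • (ι ℤ (x 5) * ι ℤ
      (x 9)) + c 5 10 • (ι ℤ (x 5) * ι ℤ (x 10)) + c 5 11 • (ι ℤ (x 5) * ι ℤ (x 11)) + c 6 7 • (ι ℤ (x 6) * ι
      ℤ (x 7)) + c 6 8 • (ι ℤ (x 6) * ι ℤ (x 8)) + c 6 9 • (ι ℤ (x 6) * ι ℤ (x 9)) + c 6 10 • (ι ℤ (x 6) * ι ℤ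
      (x 10)) + c 6 11 • (ι ℤ (x 6) * ι ℤ (x 11)) + c 7 8 • (ι ℤ (x 7) * ι ℤ (x 8)) + c 7 9 • (ι ℤ (x 7) * ι ℤ
      (x 9)) + c 7 10 • (ι ℤ (x 7) * ι ℤ (x 10)) + c 7 11 • (ι ℤ (x 7) * ι ℤ (x 11)) + c 8 9 • (ι ℤ (x 8) * ι
      ℤ (x 9)) + c 8 10 • (ι ℤ (x 8) * ι ℤ (x 10)) + c 8 11 • (ι ℤ (x 8) * ι ℤ (x 11)) + c 9 10 • (ι ℤ (x 9) *
      ι ℤ (x 10)) + c 9 11 • (ι ℤ (x 9) * ι ℤ (x 11)) + c 10 11 • (ι ℤ (x 10) * ι ℤ (x 11))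
      ∈ Submodule.span ℤ (Set.range fun p : M × M => ι ℤ p.1 * ι ℤ p.2) := by
  repeat (first
    | refine Submodule.add_mem _ ?_ ?_
    | exact Submodule.smul_mem _ _ (Submodule.subset_span ⟨(_, _), rfl⟩))

end LocalTools

section Coverage

/-! ### 1. The three parity cases of LEMMA A(b)'s functional (over `ℤ`) -/

/-- **Coverage for the `(1,2,3,3,3,3)` frame.**  For integers `β₀₁ β₂₃ n₁ n₂ n₃ n₄` with odd Pfaffian there is a
functional `f = f₀₁h₀ + f₂₃h₁ + (c₁l₁ + ⋯ + c₄l₄)` with `f₂₃ = 2r + 1` odd and EVEN pairing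
`f₀₁β₂₃ + f₂₃β₀₁ + ϖ = 2m`, `ϖ = c₂n₃ + c₃n₂ − c₁n₄ − c₄n₁` — the hypotheses `hr`, `hm`, `hϖ` of
`TwoAdicReadings.lemmaA_b_reading`.  Cases: `β₀₁` even ⟹ `f = h₁`; `β₀₁, β₂₃` odd ⟹ `f = h₀ + h₁`; `β₀₁` odd and `β₂₃`
even ⟹ `n₂n₃ − n₁n₄` is odd, so `n₁` or `n₄` is odd or `n₂, n₃` both are, and `f = h₁ ± lⱼ` for the complementary
cross line. -/
theorem mixed_coverage (β₀₁ β₂₃ n₁ n₂ n₃ n₄ p : ℤ) (hp : β₀₁ * β₂₃ + (n₂ * n₃ - n₁ * n₄) = 2 * p + 1) :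
    ∃ f₀₁ f₂₃ c₁ c₂ c₃ c₄ r m : ℤ, f₂₃ = 2 * r + 1 ∧
      f₀₁ * β₂₃ + f₂₃ * β₀₁ + (c₂ * n₃ + c₃ * n₂ - c₁ * n₄ - c₄ * n₁) = 2 * m := by
  rcases Int.even_or_odd' β₀₁ with ⟨a, ha | ha⟩
  · exact ⟨0, 1, 0, 0, 0, 0, 0, a, by ring, by rw [ha]; ring⟩
  rcases Int.even_or_odd' β₂₃ with ⟨b, hb | hb⟩
  swap
  · exact ⟨1, 1, 0, 0, 0, 0, 0, a + b + 1, by ring, by rw [ha, hb]; ring⟩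
  -- `β₀₁` odd, `β₂₃` even: the Pfaffian makes `ν = n₂n₃ − n₁n₄` odd
  have hν : Odd (n₂ * n₃ - n₁ * n₄) := ⟨p - 2 * a * b - b, by subst ha hb; linear_combination hp⟩
  rcases Int.even_or_odd' n₁ with ⟨e₁, h₁ | h₁⟩
  swap
  · exact ⟨0, 1, 0, 0, 0, -1, 0, a + e₁ + 1, by ring, by rw [ha, h₁]; ring⟩
  rcases Int.even_or_odd' n₄ with ⟨e₄, h₄ | h₄⟩
  swap
  · exact ⟨0, 1, -1, 0, 0, 0, 0, a + e₄ + 1, by ring, by rw [ha, h₄]; ring⟩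
  have h₁₄ : Even (n₁ * n₄) := ⟨2 * e₁ * e₄, by rw [h₁, h₄]; ring⟩
  obtain ⟨e₂, h₂⟩ := (Int.odd_mul.mp ((Int.odd_sub.mp hν).mpr h₁₄)).1
  exact ⟨0, 1, 0, 0, 1, 0, 0, a + e₂ + 1, by ring, by rw [ha, h₂]; ring⟩

end Coverage

section Chain

/-! ### 2. Criterion at `k = 2` ⇒ digit equation ⇒ contradiction, on the `(1,2,3,3,3,3)` frame -/

variable {M : Type*} [AddCommGroup M] [Module ℤ M]

/-- **LEMMA A(b), the whole chain (criterion at `k = 2` ⇒ contradiction).**  In `ExteriorAlgebra ℤ M` (`M` free,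
basis `x : Fin 12`; slots, cross lines, parameters ANY even elements): a non-degenerate leading digit
`C = β₀₁h₀ + β₂₃h₁ + N` (`N = n₁l₁ + ⋯ + n₄l₄`, Pfaffian `β₀₁β₂₃ + (n₂n₃ − n₁n₄) = 2p + 1`), a functional
`f = f₀₁h₀ + f₂₃h₁ + F`, `F = c₁l₁ + ⋯ + c₄l₄`, with `f₂₃ = 2r + 1` and even pairing `f₀₁β₂₃ + f₂₃β₀₁ + ϖ = 2m`, ANY
first digit `X` and remainder `Y` (divided squares `X₂, Y₂`; `E` that of `C + 2X + 4Y`), the registered `T₂` of the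
`(1,2,3,3,3,3)` type (`D = 2h₀ + 4h₁ + 8S₁`, `D₂ = 8h₀h₁ + 16h₀S₁ + 32h₁S₁ + 64S₂`, `σ₁ = 0`, `σ₀ = 2s + 1`,
`σ₂ = 4t + 2`).  IF `T₂ = 64·Z` with `Z` even THEN `False`: `MixedFrameLeadingDigit.T2_leading_mixed` in the
commutative `Λ` (table entries from `TwoSlotFrameTable`), `LeadingDigitRemainder.natCast_mul_cancel` (cancel `32`),
`TwoAdicReadings.lemmaA_b_reading` (with `e := t + s + p + 1`). -/
theorem lemmaA_b_chain (x : Module.Basis (Fin 12) ℤ M) (Λ : Subalgebra ℤ (ExteriorAlgebra ℤ M))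
    (h₀ h₁ l₁ l₂ l₃ l₄ h₂ h₃ h₄ h₅ σ₀ σ₁ σ₂ s t p m r f₀₁ f₂₃ ϖ n₁ n₂ n₃ n₄ c₁ c₂ c₃ c₄ β₀₁ β₂₃ S₁ S₂ S₄ G N N₂ F
    f C C₂ X X₂ Y Y₂ E D D₂ T₂ Z : ExteriorAlgebra ℤ M)
    (hΛ : Λ = Algebra.adjoin ℤ (Set.range fun p : M × M => ι ℤ p.1 * ι ℤ p.2))
    (hh₀ : h₀ = ι ℤ (x 0) * ι ℤ (x 1)) (hh₁ : h₁ = ι ℤ (x 2) * ι ℤ (x 3)) (hl₁ : l₁ = ι ℤ (x 0) * ι ℤ (x 2))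
    (hl₂ : l₂ = ι ℤ (x 0) * ι ℤ (x 3)) (hl₃ : l₃ = ι ℤ (x 1) * ι ℤ (x 2)) (hl₄ : l₄ = ι ℤ (x 1) * ι ℤ (x 3))
    (hh₂ : h₂ = ι ℤ (x 4) * ι ℤ (x 5)) (hh₃ : h₃ = ι ℤ (x 6) * ι ℤ (x 7)) (hh₄ : h₄ = ι ℤ (x 8) * ι ℤ (x 9))
    (hh₅ : h₅ = ι ℤ (x 10) * ι ℤ (x 11)) (ms : s ∈ Λ) (mt : t ∈ Λ) (mp : p ∈ Λ) (mm : m ∈ Λ) (mr : r ∈ Λ)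
    (mf₀₁ : f₀₁ ∈ Λ) (mf₂₃ : f₂₃ ∈ Λ) (mn₁ : n₁ ∈ Λ) (mn₂ : n₂ ∈ Λ) (mn₃ : n₃ ∈ Λ) (mn₄ : n₄ ∈ Λ) (mc₁ : c₁ ∈ Λ)
    (mc₂ : c₂ ∈ Λ) (mc₃ : c₃ ∈ Λ) (mc₄ : c₄ ∈ Λ) (mβ₀₁ : β₀₁ ∈ Λ) (mβ₂₃ : β₂₃ ∈ Λ) (mS₂ : S₂ ∈ Λ) (mX : X ∈ Λ)
    (mX₂ : X₂ ∈ Λ) (mY : Y ∈ Λ) (mY₂ : Y₂ ∈ Λ) (mZ : Z ∈ Λ)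
    (hS₁ : S₁ = h₂ + h₃ + h₄ + h₅) (hS₄ : S₄ = h₂ * h₃ * h₄ * h₅) (hG : G = h₃ * h₄ * h₅)
    (hN : N = n₁ * l₁ + n₂ * l₂ + n₃ * l₃ + n₄ * l₄)
    (hN₂ : N₂ = n₁ * l₁ * (n₂ * l₂) + n₁ * l₁ * (n₃ * l₃) + n₁ * l₁ * (n₄ * l₄) + n₂ * l₂ * (n₃ * l₃)
      + n₂ * l₂ * (n₄ * l₄) + n₃ * l₃ * (n₄ * l₄))
    (hF : F = c₁ * l₁ + c₂ * l₂ + c₃ * l₃ + c₄ * l₄) (hϖ : ϖ = c₂ * n₃ + c₃ * n₂ - c₁ * n₄ - c₄ * n₁)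
    (hC : C = β₀₁ * h₀ + β₂₃ * h₁ + N) (hC₂ : C₂ = β₀₁ * β₂₃ * (h₀ * h₁) + (β₀₁ * h₀ + β₂₃ * h₁) * N + N₂)
    (hf : f = f₀₁ * h₀ + f₂₃ * h₁ + F)
    (hE : E = C₂ + 2 * (C * X) + 4 * (C * Y) + 4 * X₂ + 8 * (X * Y) + 16 * Y₂)
    (hD : D = 2 * h₀ + 4 * h₁ + 8 * S₁) (hD₂ : D₂ = 8 * (h₀ * h₁) + 16 * (h₀ * S₁) + 32 * (h₁ * S₁) + 64 * S₂)
    (hT₂ : T₂ = σ₂ * D₂ - 4 * σ₁ * (D * (C + 2 * X + 4 * Y)) + 16 * σ₀ * E)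
    (hp : β₀₁ * β₂₃ + (n₂ * n₃ - n₁ * n₄) = 2 * p + 1) (hm : f₀₁ * β₂₃ + f₂₃ * β₀₁ + ϖ = 2 * m)
    (hr : f₂₃ = 2 * r + 1) (hσ₁ : σ₁ = 0) (hσ₂ : σ₂ = 4 * t + 2) (hσ₀ : σ₀ = 2 * s + 1) (hcrit : T₂ = 64 * Z) :
    False := by
  -- LEMMA A(b)'s reading with `e := t + s + p + 1`, the witness `W` universally quantified
  have me : t + s + p + 1 ∈ Λ := Λ.add_mem (Λ.add_mem (Λ.add_mem mt ms) mp) Λ.one_mem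
  have hne : ∀ W ∈ Λ, (t + s + p + 1) * (h₀ * h₁) + h₀ * S₁ + C * X ≠ 2 * W := fun W mW =>
    lemmaA_b_reading x Λ h₀ h₁ l₁ l₂ l₃ l₄ h₂ h₃ h₄ h₅ m r (t + s + p + 1) f₀₁ f₂₃ ϖ β₀₁ β₂₃ n₁ n₂ n₃ n₄ c₁ c₂
      c₃ c₄ S₁ S₄ G N F f C X W hΛ hh₀ hh₁ hl₁ hl₂ hl₃ hl₄ hh₂ hh₃ hh₄ hh₅ mm mr me mf₀₁ mf₂₃ mβ₀₁ mβ₂₃ mn₁ mn₂ mn₃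
      mn₄ mc₁ mc₂ mc₃ mc₄ mX mW hS₁ hS₄ hG hN hF hϖ hC hf hm hr
  -- `T2_leading_mixed` in the commutative ring Λ
  subst hΛ
  haveI := TwoSlotGlue.isMulCommutative_twoVectorSubalgebra (R := ℤ) (M := M)
  set Λ := Algebra.adjoin ℤ (Set.range fun p : M × M => ι ℤ p.1 * ι ℤ p.2)
  have mh₀ : h₀ ∈ Λ := Algebra.subset_adjoin ⟨(x 0, x 1), hh₀.symm⟩
  have mh₁ : h₁ ∈ Λ := Algebra.subset_adjoin ⟨(x 2, x 3), hh₁.symm⟩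
  have ml₁ : l₁ ∈ Λ := Algebra.subset_adjoin ⟨(x 0, x 2), hl₁.symm⟩
  have ml₂ : l₂ ∈ Λ := Algebra.subset_adjoin ⟨(x 0, x 3), hl₂.symm⟩
  have ml₃ : l₃ ∈ Λ := Algebra.subset_adjoin ⟨(x 1, x 2), hl₃.symm⟩
  have ml₄ : l₄ ∈ Λ := Algebra.subset_adjoin ⟨(x 1, x 3), hl₄.symm⟩
  have mh₂ : h₂ ∈ Λ := Algebra.subset_adjoin ⟨(x 4, x 5), hh₂.symm⟩
  have mh₃ : h₃ ∈ Λ := Algebra.subset_adjoin ⟨(x 6, x 7), hh₃.symm⟩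
  have mh₄ : h₄ ∈ Λ := Algebra.subset_adjoin ⟨(x 8, x 9), hh₄.symm⟩
  have mh₅ : h₅ ∈ Λ := Algebra.subset_adjoin ⟨(x 10, x 11), hh₅.symm⟩
  have qh₀ : (⟨h₀, mh₀⟩ : Λ) * ⟨h₀, mh₀⟩ = 0 := Subtype.ext (by subst hh₀; exact twoVector_mul_self (x 0) (x 1))
  have qh₁ : (⟨h₁, mh₁⟩ : Λ) * ⟨h₁, mh₁⟩ = 0 := Subtype.ext (by subst hh₁; exact twoVector_mul_self (x 2) (x 3))
  have zh₀l₁ : (⟨h₀, mh₀⟩ : Λ) * ⟨l₁, ml₁⟩ = 0 := Subtype.ext (by subst hh₀ hl₁; exact table_zero_ff (x 0) (x 1) (x 2))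
  have zh₀l₂ : (⟨h₀, mh₀⟩ : Λ) * ⟨l₂, ml₂⟩ = 0 := Subtype.ext (by subst hh₀ hl₂; exact table_zero_ff (x 0) (x 1) (x 3))
  have zh₀l₃ : (⟨h₀, mh₀⟩ : Λ) * ⟨l₃, ml₃⟩ = 0 := Subtype.ext (by subst hh₀ hl₃; exact table_zero_st (x 0) (x 1) (x 2))
  have zh₀l₄ : (⟨h₀, mh₀⟩ : Λ) * ⟨l₄, ml₄⟩ = 0 := Subtype.ext (by subst hh₀ hl₄; exact table_zero_st (x 0) (x 1) (x 3))
  have zh₁l₁ : (⟨h₁, mh₁⟩ : Λ) * ⟨l₁, ml₁⟩ = 0 := Subtype.ext (by subst hh₁ hl₁; exact table_zero_fl (x 2) (x 3) (x 0))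
  have zh₁l₂ : (⟨h₁, mh₁⟩ : Λ) * ⟨l₂, ml₂⟩ = 0 := Subtype.ext (by subst hh₁ hl₂; exact table_zero_sl (x 2) (x 3) (x 0))
  have zh₁l₃ : (⟨h₁, mh₁⟩ : Λ) * ⟨l₃, ml₃⟩ = 0 := Subtype.ext (by subst hh₁ hl₃; exact table_zero_fl (x 2) (x 3) (x 1))
  have zh₁l₄ : (⟨h₁, mh₁⟩ : Λ) * ⟨l₄, ml₄⟩ = 0 := Subtype.ext (by subst hh₁ hl₄; exact table_zero_sl (x 2) (x 3) (x 1))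
  have zl₁l₂ : (⟨l₁, ml₁⟩ : Λ) * ⟨l₂, ml₂⟩ = 0 := Subtype.ext (by subst hl₁ hl₂; exact table_zero_ff (x 0) (x 2) (x 3))
  have zl₁l₃ : (⟨l₁, ml₁⟩ : Λ) * ⟨l₃, ml₃⟩ = 0 := Subtype.ext (by subst hl₁ hl₃; exact table_zero_sl (x 0) (x 2) (x 1))
  have zl₂l₄ : (⟨l₂, ml₂⟩ : Λ) * ⟨l₄, ml₄⟩ = 0 := Subtype.ext (by subst hl₂ hl₄; exact table_zero_sl (x 0) (x 3) (x 1))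
  have zl₃l₄ : (⟨l₃, ml₃⟩ : Λ) * ⟨l₄, ml₄⟩ = 0 := Subtype.ext (by subst hl₃ hl₄; exact table_zero_ff (x 1) (x 2) (x 3))
  have pl₁l₄ : (⟨l₁, ml₁⟩ : Λ) * ⟨l₄, ml₄⟩ = -(⟨h₀, mh₀⟩ * ⟨h₁, mh₁⟩) :=
    Subtype.ext (by subst hl₁ hl₄ hh₀ hh₁; exact (table_signed (x 0) (x 1) (x 2) (x 3)).1)
  have pl₂l₃ : (⟨l₂, ml₂⟩ : Λ) * ⟨l₃, ml₃⟩ = ⟨h₀, mh₀⟩ * ⟨h₁, mh₁⟩ :=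
    Subtype.ext (by subst hl₂ hl₃ hh₀ hh₁; exact (table_signed (x 0) (x 1) (x 2) (x 3)).2)
  have mN : N ∈ Λ := by
    subst hN; exact Λ.add_mem (Λ.add_mem (Λ.add_mem (Λ.mul_mem mn₁ ml₁) (Λ.mul_mem mn₂ ml₂))
      (Λ.mul_mem mn₃ ml₃)) (Λ.mul_mem mn₄ ml₄)
  have hNΛ : (⟨N, mN⟩ : Λ) = ⟨n₁, mn₁⟩ * ⟨l₁, ml₁⟩ + ⟨n₂, mn₂⟩ * ⟨l₂, ml₂⟩ + ⟨n₃, mn₃⟩ * ⟨l₃, ml₃⟩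
      + ⟨n₄, mn₄⟩ * ⟨l₄, ml₄⟩ := Subtype.ext (by push_cast; exact hN)
  have zh₀N := crossLine_h₀ (⟨h₀, mh₀⟩ : Λ) ⟨l₁, ml₁⟩ ⟨l₂, ml₂⟩ ⟨l₃, ml₃⟩ ⟨l₄, ml₄⟩ ⟨n₁, mn₁⟩ ⟨n₂, mn₂⟩
    ⟨n₃, mn₃⟩ ⟨n₄, mn₄⟩ ⟨N, mN⟩ hNΛ zh₀l₁ zh₀l₂ zh₀l₃ zh₀l₄
  have zh₁N := crossLine_h₁ (⟨h₁, mh₁⟩ : Λ) ⟨l₁, ml₁⟩ ⟨l₂, ml₂⟩ ⟨l₃, ml₃⟩ ⟨l₄, ml₄⟩ ⟨n₁, mn₁⟩ ⟨n₂, mn₂⟩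
    ⟨n₃, mn₃⟩ ⟨n₄, mn₄⟩ ⟨N, mN⟩ hNΛ zh₁l₁ zh₁l₂ zh₁l₃ zh₁l₄
  have mN₂ : N₂ ∈ Λ := by
    subst hN₂
    exact Λ.add_mem (Λ.add_mem (Λ.add_mem (Λ.add_mem (Λ.add_mem
      (Λ.mul_mem (Λ.mul_mem mn₁ ml₁) (Λ.mul_mem mn₂ ml₂)) (Λ.mul_mem (Λ.mul_mem mn₁ ml₁) (Λ.mul_mem mn₃ ml₃)))
      (Λ.mul_mem (Λ.mul_mem mn₁ ml₁) (Λ.mul_mem mn₄ ml₄))) (Λ.mul_mem (Λ.mul_mem mn₂ ml₂) (Λ.mul_mem mn₃ ml₃)))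
      (Λ.mul_mem (Λ.mul_mem mn₂ ml₂) (Λ.mul_mem mn₄ ml₄))) (Λ.mul_mem (Λ.mul_mem mn₃ ml₃) (Λ.mul_mem mn₄ ml₄))
  have hN₂Λ := crossLine_dividedSquare (⟨h₀, mh₀⟩ : Λ) ⟨h₁, mh₁⟩ ⟨l₁, ml₁⟩ ⟨l₂, ml₂⟩ ⟨l₃, ml₃⟩ ⟨l₄, ml₄⟩
    ⟨n₁, mn₁⟩ ⟨n₂, mn₂⟩ ⟨n₃, mn₃⟩ ⟨n₄, mn₄⟩ ⟨N₂, mN₂⟩ (Subtype.ext (by push_cast; exact hN₂)) zl₁l₂ zl₁l₃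
    zl₂l₄ zl₃l₄ pl₁l₄ pl₂l₃
  have mS₁ : S₁ ∈ Λ := by subst hS₁; exact Λ.add_mem (Λ.add_mem (Λ.add_mem mh₂ mh₃) mh₄) mh₅
  have hPfΛ : (⟨n₂, mn₂⟩ * ⟨n₃, mn₃⟩ - ⟨n₁, mn₁⟩ * ⟨n₄, mn₄⟩ : Λ)
      = 2 * ⟨p, mp⟩ + 1 - ⟨β₀₁, mβ₀₁⟩ * ⟨β₂₃, mβ₂₃⟩ :=
    Subtype.ext (by change n₂ * n₃ - n₁ * n₄ = 2 * p + 1 - β₀₁ * β₂₃; rw [← hp]; abel)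
  subst hC hC₂ hE hD hD₂ hT₂ hσ₁ hσ₂ hσ₀
  have pack : ∀ {T Q W : Λ}, T = 32 * Q + 64 * W → ∃ W' : Λ, T = 32 * Q + 64 * W' := fun h => ⟨_, h⟩
  obtain ⟨W₁, hW₁⟩ := pack (T2_leading_mixed (R := Λ) ⟨h₀, mh₀⟩ ⟨h₁, mh₁⟩ _ _ _ ⟨s, ms⟩ ⟨t, mt⟩ ⟨p, mp⟩ _
    ⟨β₀₁, mβ₀₁⟩ ⟨β₂₃, mβ₂₃⟩ ⟨S₁, mS₁⟩ ⟨S₂, mS₂⟩ ⟨N, mN⟩ ⟨N₂, mN₂⟩ _ _ _ _ ⟨X, mX⟩ ⟨X₂, mX₂⟩ ⟨Y, mY⟩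
    ⟨Y₂, mY₂⟩ _ _ rfl rfl rfl rfl rfl rfl qh₀ qh₁ zh₀N zh₁N hN₂Λ hPfΛ rfl rfl rfl)
  have key := congrArg Subtype.val hW₁
  push_cast at key
  have key' : (64 : ExteriorAlgebra ℤ M) * Z
      = 32 * ((t + s + p + 1) * (h₀ * h₁) + h₀ * S₁ + (β₀₁ * h₀ + β₂₃ * h₁ + N) * X) + 64 * (W₁ : ExteriorAlgebra ℤ M) :=
    hcrit.symm.trans key
  -- cancel 32
  have h32 : (32 : ExteriorAlgebra ℤ M) * ((t + s + p + 1) * (h₀ * h₁) + h₀ * S₁ + (β₀₁ * h₀ + β₂₃ * h₁ + N) * X)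
      = 32 * (2 * (Z - ↑W₁)) := by
    rw [eq_sub_of_add_eq key'.symm]
    simp only [mul_sub, ← mul_assoc]
    norm_num
  have hQ := natCast_mul_cancel x 32 (by norm_num) _ _ (by exact_mod_cast h32)
  exact hne (Z - ↑W₁) (Λ.sub_mem mZ W₁.2) hQ

end Chain

section Composition

/-! ### 3. The `(1,2,3,3,3,3)` frame is CLASS-DEAD -/

variable {M : Type*} [AddCommGroup M] [Module ℤ M]

set_option maxHeartbeats 800000 in
/-- **THE (1,2,3,3,3,3) FRAME IS CLASS-DEAD.**  `M` free with basis `x : Fin 12`; an INTEGRAL leading digit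
`C = β₀₁h₀ + β₂₃h₁ + Σ nᵢlᵢ` with odd Pfaffian; ANY integral 2-form `X` (66 coefficients); the class 2-form
`B = C + 2X` and ANY `B₂` with `B·B = 2B₂` (its divided square); the type `D = 2h₀ + 4h₁ + 8S₁` with the registered
`D₂ = 8h₀h₁ + 16h₀S₁ + 32h₁S₁ + 64S₂`; a signature `σ₁ = 0`, `σ₀ = 2s + 1`, `σ₂ = 4t + 2` (`s, t` any even elements);
the registered `T₂(B) = σ₂D₂ − 4σ₁DB + 16σ₀B₂`.  THEN `T₂(B) ≠ 64·Z` for every even `Z`: CRITERION L fails at `k = 2`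
for every completion of every non-degenerate leading digit of this frame (the 63 classes carry no class satisfying
CRITERION L — given the framework words of the module docstring). -/
theorem mixedFrame_classDead (x : Module.Basis (Fin 12) ℤ M) (Λ : Subalgebra ℤ (ExteriorAlgebra ℤ M))
    (h₀ h₁ l₁ l₂ l₃ l₄ h₂ h₃ h₄ h₅ σ₀ σ₁ σ₂ s t S₁ S₂ D D₂ C X B B₂ T₂ : ExteriorAlgebra ℤ M)
    (β₀₁ β₂₃ n₁ n₂ n₃ n₄ p : ℤ) (c : Fin 12 → Fin 12 → ℤ)
    (hΛ : Λ = Algebra.adjoin ℤ (Set.range fun p : M × M => ι ℤ p.1 * ι ℤ p.2))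
    (hh₀ : h₀ = ι ℤ (x 0) * ι ℤ (x 1)) (hh₁ : h₁ = ι ℤ (x 2) * ι ℤ (x 3)) (hl₁ : l₁ = ι ℤ (x 0) * ι ℤ (x 2))
    (hl₂ : l₂ = ι ℤ (x 0) * ι ℤ (x 3)) (hl₃ : l₃ = ι ℤ (x 1) * ι ℤ (x 2)) (hl₄ : l₄ = ι ℤ (x 1) * ι ℤ (x 3))
    (hh₂ : h₂ = ι ℤ (x 4) * ι ℤ (x 5)) (hh₃ : h₃ = ι ℤ (x 6) * ι ℤ (x 7)) (hh₄ : h₄ = ι ℤ (x 8) * ι ℤ (x 9))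
    (hh₅ : h₅ = ι ℤ (x 10) * ι ℤ (x 11)) (ms : s ∈ Λ) (mt : t ∈ Λ)
    (hS₁ : S₁ = h₂ + h₃ + h₄ + h₅) (hS₂ : S₂ = h₂ * h₃ + h₂ * h₄ + h₂ * h₅ + h₃ * h₄ + h₃ * h₅ + h₄ * h₅)
    (hD : D = 2 * h₀ + 4 * h₁ + 8 * S₁) (hD₂ : D₂ = 8 * (h₀ * h₁) + 16 * (h₀ * S₁) + 32 * (h₁ * S₁) + 64 * S₂)
    (hC : C = (β₀₁ : ExteriorAlgebra ℤ M) * h₀ + (β₂₃ : ExteriorAlgebra ℤ M) * h₁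
      + ((n₁ : ExteriorAlgebra ℤ M) * l₁ + (n₂ : ExteriorAlgebra ℤ M) * l₂ + (n₃ : ExteriorAlgebra ℤ M) * l₃ + (n₄ : ExteriorAlgebra ℤ M) * l₄))
    (hp : β₀₁ * β₂₃ + (n₂ * n₃ - n₁ * n₄) = 2 * p + 1)
    (hX : X = c 0 1 • (ι ℤ (x 0) * ι ℤ (x 1)) + c 0 2 • (ι ℤ (x 0) * ι ℤ (x 2)) + c 0 3 • (ι ℤ (x 0) * ι ℤ (x 3)) + c 0 4 •
      (ι ℤ (x 0) * ι ℤ (x 4)) + c 0 5 • (ι ℤ (x 0) * ι ℤ (x 5)) + c 0 6 • (ι ℤ (x 0) * ι ℤ (x 6)) + c 0 7 • (ι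
      ℤ (x 0) * ι ℤ (x 7)) + c 0 8 • (ι ℤ (x 0) * ι ℤ (x 8)) + c 0 9 • (ι ℤ (x 0) * ι ℤ (x 9)) + c 0 10 • (ι ℤ
      (x 0) * ι ℤ (x 10)) + c 0 11 • (ι ℤ (x 0) * ι ℤ (x 11)) + c 1 2 • (ι ℤ (x 1) * ι ℤ (x 2)) + c 1 3 • (ι ℤ
      (x 1) * ι ℤ (x 3)) + c 1 4 • (ι ℤ (x 1) * ι ℤ (x 4)) + c 1 5 • (ι ℤ (x 1) * ι ℤ (x 5)) + c 1 6 • (ι ℤ (x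
      1) * ι ℤ (x 6)) + c 1 7 • (ι ℤ (x 1) * ι ℤ (x 7)) + c 1 8 • (ι ℤ (x 1) * ι ℤ (x 8)) + c 1 9 • (ι ℤ (x 1)
      * ι ℤ (x 9)) + c 1 10 • (ι ℤ (x 1) * ι ℤ (x 10)) + c 1 11 • (ι ℤ (x 1) * ι ℤ (x 11)) + c 2 3 • (ι ℤ (x
      2) * ι ℤ (x 3)) + c 2 4 • (ι ℤ (x 2) * ι ℤ (x 4)) + c 2 5 • (ι ℤ (x 2) * ι ℤ (x 5)) + c 2 6 • (ι ℤ (x 2)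
      * ι ℤ (x 6)) + c 2 7 • (ι ℤ (x 2) * ι ℤ (x 7)) + c 2 8 • (ι ℤ (x 2) * ι ℤ (x 8)) + c 2 9 • (ι ℤ (x 2) *
      ι ℤ (x 9)) + c 2 10 • (ι ℤ (x 2) * ι ℤ (x 10)) + c 2 11 • (ι ℤ (x 2) * ι ℤ (x 11)) + c 3 4 • (ι ℤ (x 3)
      * ι ℤ (x 4)) + c 3 5 • (ι ℤ (x 3) * ι ℤ (x 5)) + c 3 6 • (ι ℤ (x 3) * ι ℤ (x 6)) + c 3 7 • (ι ℤ (x 3) *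
      ι ℤ (x 7)) + c 3 8 • (ι ℤ (x 3) * ι ℤ (x 8)) + c 3 9 • (ι ℤ (x 3) * ι ℤ (x 9)) + c 3 10 • (ι ℤ (x 3) * ι
      ℤ (x 10)) + c 3 11 • (ι ℤ (x 3) * ι ℤ (x 11)) + c 4 5 • (ι ℤ (x 4) * ι ℤ (x 5)) + c 4 6 • (ι ℤ (x 4) * ι
      ℤ (x 6)) + c 4 7 • (ι ℤ (x 4) * ι ℤ (x 7)) + c 4 8 • (ι ℤ (x 4) * ι ℤ (x 8)) + c 4 9 • (ι ℤ (x 4) * ι ℤ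
      (x 9)) + c 4 10 • (ι ℤ (x 4) * ι ℤ (x 10)) + c 4 11 • (ι ℤ (x 4) * ι ℤ (x 11)) + c 5 6 • (ι ℤ (x 5) * ι
      ℤ (x 6)) + c 5 7 • (ι ℤ (x 5) * ι ℤ (x 7)) + c 5 8 • (ι ℤ (x 5) * ι ℤ (x 8)) + c 5 9 • (ι ℤ (x 5) * ι ℤ
      (x 9)) + c 5 10 • (ι ℤ (x 5) * ι ℤ (x 10)) + c 5 11 • (ι ℤ (x 5) * ι ℤ (x 11)) + c 6 7 • (ι ℤ (x 6) * ι
      ℤ (x 7)) + c 6 8 • (ι ℤ (x 6) * ι ℤ (x 8)) + c 6 9 • (ι ℤ (x 6) * ι ℤ (x 9)) + c 6 10 • (ι ℤ (x 6) * ι ℤ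
      (x 10)) + c 6 11 • (ι ℤ (x 6) * ι ℤ (x 11)) + c 7 8 • (ι ℤ (x 7) * ι ℤ (x 8)) + c 7 9 • (ι ℤ (x 7) * ι ℤ
      (x 9)) + c 7 10 • (ι ℤ (x 7) * ι ℤ (x 10)) + c 7 11 • (ι ℤ (x 7) * ι ℤ (x 11)) + c 8 9 • (ι ℤ (x 8) * ι
      ℤ (x 9)) + c 8 10 • (ι ℤ (x 8) * ι ℤ (x 10)) + c 8 11 • (ι ℤ (x 8) * ι ℤ (x 11)) + c 9 10 • (ι ℤ (x 9) *
      ι ℤ (x 10)) + c 9 11 • (ι ℤ (x 9) * ι ℤ (x 11)) + c 10 11 • (ι ℤ (x 10) * ι ℤ (x 11)))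
    (hB : B = C + 2 * X) (qB : B * B = 2 * B₂)
    (hσ₁ : σ₁ = 0) (hσ₂ : σ₂ = 4 * t + 2) (hσ₀ : σ₀ = 2 * s + 1)
    (hT₂ : T₂ = σ₂ * D₂ - 4 * σ₁ * (D * B) + 16 * σ₀ * B₂) :
    ∀ Z ∈ Λ, T₂ ≠ 64 * Z := by
  intro Z mZ hcrit
  have mh₂ : h₂ ∈ Λ := hΛ ▸ Algebra.subset_adjoin ⟨(x 4, x 5), hh₂.symm⟩
  have mh₃ : h₃ ∈ Λ := hΛ ▸ Algebra.subset_adjoin ⟨(x 6, x 7), hh₃.symm⟩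
  have mh₄ : h₄ ∈ Λ := hΛ ▸ Algebra.subset_adjoin ⟨(x 8, x 9), hh₄.symm⟩
  have mh₅ : h₅ ∈ Λ := hΛ ▸ Algebra.subset_adjoin ⟨(x 10, x 11), hh₅.symm⟩
  have mS₂ : S₂ ∈ Λ := by
    rw [hS₂]; exact Λ.add_mem (Λ.add_mem (Λ.add_mem (Λ.add_mem (Λ.add_mem (Λ.mul_mem mh₂ mh₃)
      (Λ.mul_mem mh₂ mh₄)) (Λ.mul_mem mh₂ mh₅)) (Λ.mul_mem mh₃ mh₄)) (Λ.mul_mem mh₃ mh₅)) (Λ.mul_mem mh₄ mh₅)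
  have mk : ∀ k : ℤ, (k : ExteriorAlgebra ℤ M) ∈ Λ := fun k => Subalgebra.intCast_mem Λ k
  have span_le : Submodule.span ℤ (Set.range fun p : M × M => ι ℤ p.1 * ι ℤ p.2) ≤ Subalgebra.toSubmodule Λ := by
    rw [hΛ]; exact Algebra.span_le_adjoin ℤ _
  -- the first digit and its divided powers (ROW H), the closed form of `B₂` (ROW I + cancellation)
  have mXspan : X ∈ Submodule.span ℤ (Set.range fun p : M × M => ι ℤ p.1 * ι ℤ p.2) := hX ▸ twoForm_mem_span x c
  have mX : X ∈ Λ := span_le mXspan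
  obtain ⟨X₂, mX₂', X₃, mX₃', qX, cX⟩ := exists_dividedPowers_of_mem_span X mXspan
  have mX₂ : X₂ ∈ Λ := hΛ ▸ mX₂'
  have mX₃ : X₃ ∈ Λ := hΛ ▸ mX₃'
  obtain ⟨k₂, -⟩ := closedForms_leading (R := ℤ) x Λ h₀ h₁ l₁ l₂ l₃ l₄ (n₁ : ExteriorAlgebra ℤ M) (n₂ : ExteriorAlgebra ℤ M) (n₃ : ExteriorAlgebra ℤ M) (n₄ : ExteriorAlgebra ℤ M)
    (β₀₁ : ExteriorAlgebra ℤ M) (β₂₃ : ExteriorAlgebra ℤ M) _ _ C _ _ X X₂ X₃ B hΛ hh₀ hh₁ hl₁ hl₂ hl₃ hl₄ (mk n₁) (mk n₂) (mk n₃) (mk n₄) (mk β₀₁)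
    (mk β₂₃) mX mX₂ mX₃ rfl rfl hC rfl rfl qX cX hB
  have hB₂c := cancel_two x (qB.symm.trans k₂)
  -- the functional (three parity cases) and the chain
  obtain ⟨f₀₁, f₂₃, c₁, c₂, c₃, c₄, r, m, hr, hm⟩ := mixed_coverage β₀₁ β₂₃ n₁ n₂ n₃ n₄ p hp
  have hpA : (β₀₁ : ExteriorAlgebra ℤ M) * (β₂₃ : ExteriorAlgebra ℤ M) + ((n₂ : ExteriorAlgebra ℤ M) * (n₃ : ExteriorAlgebra ℤ M) - (n₁ : ExteriorAlgebra ℤ M) * (n₄ : ExteriorAlgebra ℤ M)) = 2 * (p : ExteriorAlgebra ℤ M) + 1 := by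
    exact_mod_cast congrArg (Int.cast : ℤ → ExteriorAlgebra ℤ M) hp
  have hrA : (f₂₃ : ExteriorAlgebra ℤ M) = 2 * (r : ExteriorAlgebra ℤ M) + 1 := by exact_mod_cast congrArg (Int.cast : ℤ → ExteriorAlgebra ℤ M) hr
  have hmA : (f₀₁ : ExteriorAlgebra ℤ M) * (β₂₃ : ExteriorAlgebra ℤ M) + (f₂₃ : ExteriorAlgebra ℤ M) * (β₀₁ : ExteriorAlgebra ℤ M) + ((c₂ : ExteriorAlgebra ℤ M) * (n₃ : ExteriorAlgebra ℤ M) + (c₃ : ExteriorAlgebra ℤ M) * (n₂ : ExteriorAlgebra ℤ M)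
      - (c₁ : ExteriorAlgebra ℤ M) * (n₄ : ExteriorAlgebra ℤ M) - (c₄ : ExteriorAlgebra ℤ M) * (n₁ : ExteriorAlgebra ℤ M)) = 2 * (m : ExteriorAlgebra ℤ M) := by
    exact_mod_cast congrArg (Int.cast : ℤ → ExteriorAlgebra ℤ M) hm
  exact lemmaA_b_chain x Λ h₀ h₁ l₁ l₂ l₃ l₄ h₂ h₃ h₄ h₅ σ₀ σ₁ σ₂ s t (p : ExteriorAlgebra ℤ M) (m : ExteriorAlgebra ℤ M) (r : ExteriorAlgebra ℤ M) (f₀₁ : ExteriorAlgebra ℤ M)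
    (f₂₃ : ExteriorAlgebra ℤ M) _ (n₁ : ExteriorAlgebra ℤ M) (n₂ : ExteriorAlgebra ℤ M) (n₃ : ExteriorAlgebra ℤ M) (n₄ : ExteriorAlgebra ℤ M) (c₁ : ExteriorAlgebra ℤ M) (c₂ : ExteriorAlgebra ℤ M) (c₃ : ExteriorAlgebra ℤ M) (c₄ : ExteriorAlgebra ℤ M)
    (β₀₁ : ExteriorAlgebra ℤ M) (β₂₃ : ExteriorAlgebra ℤ M) S₁ S₂ _ _ _ _ _ _ C _ X X₂ 0 0 B₂ D D₂ T₂ Z hΛ hh₀ hh₁ hl₁ hl₂ hl₃ hl₄ hh₂ hh₃ hh₄ hh₅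
    ms mt (mk p) (mk m) (mk r) (mk f₀₁) (mk f₂₃) (mk n₁) (mk n₂) (mk n₃) (mk n₄) (mk c₁) (mk c₂) (mk c₃) (mk c₄)
    (mk β₀₁) (mk β₂₃) mS₂ mX mX₂ Λ.zero_mem Λ.zero_mem mZ hS₁ rfl rfl rfl rfl rfl rfl hC rfl rfl
    (hB₂c.trans (by simp only [mul_zero, add_zero])) hD hD₂ (by rw [hT₂, hB]; simp only [mul_zero, add_zero])
    hpA hmA hrA hσ₁ hσ₂ hσ₀ hcrit

end Composition

end Summit.Ventures.HSemireg.MixedFrameClassDead
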